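import Literature.Barriers.NavierStokesRegularity.InstantaneousTypeIBlowupLacunary
import Mathlib.Analysis.MeanInequalities
import HarnessLib

/-!
# Cheskidov–Dai–Palasek 2025, Thm. 1.1: proof architecture three levels down —
# hypothesis `h₂` from block-type bounds of the principal part (Prop. 4.3) and the corrector

Fourth sibling proof file (all results proved; no definitions, no named facts) of the barrier
entry `Literature/Barriers/NavierStokesRegularity/InstantaneousTypeIBlowup` (A. Cheskidov, M. Dai,
S. Palasek, arXiv:2511.09556 (2025), Thm. 1.1). `construction_of_decomposition`
(`InstantaneousTypeIBlowupDecomposition`) reduced the fact to a hypothesis `h₂` on the summands of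
`u = U(· + T_*) + v + w`; four of its clauses about the principal part `v` and two about `u` are
CONSEQUENCES of the displayed bounds of Prop. 4.3 (with Prop. 4.2),

  `‖∇ⁿ v_k(t)‖_{L^p} ≲ N_{1,k+1}^{-α}(t^{-1/2-n/2+α} + 1) + 2^{-k/p} ∑_j N_{j,k}^{1+n} e^{-N_{j,k}²t}`
  (display (4.20) in the proof of Prop. 4.3, `n = 0, 1`, `1 ≤ p ≤ ∞`), summed over `k`:
  `‖v(t,x)‖ ≤ E(t^{α-1/2} + 1) + C ∑ₖ N_k e^{-cN_k²t}`, `‖∇v(t,x)‖ ≤ E(t^{α-1} + 1) + C ∑ₖ N_k² e^{-cN_k²t}`,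
  `‖v(t)‖_{L^p} ≤ E(t^{α-1/2} + 1) + C ∑ₖ 2^{-k/p} N_k e^{-cN_k²t}`,

over the double-exponential scales of §3.1, together with the bounds of the corrector
(`‖w(t)‖ ≤ δ t^{-β₀}`, Prop. 5.3) and of the smooth background: namely the Type-I bounds of `v`
(Prop. 4.3 (v-pointwise-bounds): the lacunary Gaussian sums `∑ N_k^a e^{-cN_k²t} ≲ t^{-a/2}` of
`LacunaryScaleSums`), the Orlicz bounds (5) for `v` (`InstantaneousTypeIBlowupLacunary`), and the
classes `u ∈ L²_{t,x}`, `u ∈ L²_t L^p_x` of Prop. 6.2 ("`‖v_k‖_{L²_t L^p_x} ≲ N_{1,k+1}^{-α} + 2^{-k/p}`;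
summing in `k` proves the claim" — here by Cauchy–Schwarz in `k` and Tonelli:
`∫₀^∞ (∑ₖ ε_k N_k e^{-cN_k²t})² dt ≤ (∑ₖ ε_k)²/(2c)`, `lintegral_sq_tsum_le`). This file proves that
reduction:

* `lintegral_sq_tsum_le` and its summability / continuity companions (pure real analysis);
* `toReal_eLpNorm_add_three_le`, `memLqLp_two_of_le`, `lintegral_lintegral_sq_lt_top_of_le`
  (mixed-norm bookkeeping on `𝕋ⁿ`);
* `construction_of_blockBounds` — hypothesis `h₃` (classical solution `U(·+T_*) + v + w`; `v`
  jointly smooth on `(0, T - T_*]`; the three block-type bounds of `v` above over scales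
  `N_{k+1} ≥ 2N_k`, `N_k ≥ exp(exp(κ(k+1)))`; the corrector bounds; the lower bound of `v`; the
  `𝒟'`-limits of `v` and `w`) implies hypothesis `h₂` of `construction_of_decomposition`;
  `InstantaneousTypeIBlowup_of_blockBounds` — `h₃ → InstantaneousTypeIBlowup`.

Remaining obligation (hypothesis `h₃`; SIZE XL): §3 (the principal part, with
`NashGeometricLemmaRational` for §3.2), §4 (Props. 4.1–4.3 with App. Lemmas 7.1–7.3: the three
block bounds and the forcing `f`), §5 (Lemma 5.1, Props. 5.2–5.3: the corrector `w`, its bounds,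
classicality of `u`), the `𝒟'`-limits (Prop. 6.2 / §5) and the lower bound
"`v(tₙ) ∼ tₙ^{-1/2} e^{-1}`" (proof of Thm. 1.1).

## References

* A. Cheskidov, M. Dai, S. Palasek, arXiv:2511.09556 (2025): Thm. 1.1, §3.1, Prop. 4.2,
  Prop. 4.3 and its proof (4.20), Prop. 5.3, Prop. 6.2 and its proof (last paragraph), proof of
  Thm. 1.1 (§6). [`CheskidovDaiPalasek2025`]
-/

noncomputable section

open MeasureTheory Set Filter Topology
open scoped ENNReal InnerProductSpace

namespace Literature.Barriers.NavierStokesRegularity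

open Literature.Analysis
open Literature.Analysis.FluidPDE (exists_tsum_rpow_mul_exp_neg_le_of_lacunary
  summable_rpow_mul_exp_neg_of_lacunary continuousOn_tsum_mul_exp_neg_of_lacunary)
open Literature.Analysis.FunctionSpaces.Torus (IsSmooth IsSmoothSpaceTimeOn)

/-! ## Weighted Gaussian scale sums in `L²` of time: Cauchy–Schwarz in `k` and Tonelli -/

section TimeL2

variable {ε N : ℕ → ℝ}

/-- `x² e^{-c x² t} ≤ 1/(ct)` for `c, t > 0` (`s ≤ eˢ`). [folklore] -/
theorem sq_mul_exp_neg_le {x c t : ℝ} (hc : 0 < c) (ht : 0 < t) :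
    x ^ 2 * Real.exp (-(c * x ^ 2 * t)) ≤ 1 / (c * t) := by
  have hs : c * x ^ 2 * t ≤ Real.exp (c * x ^ 2 * t) := by
    have := Real.add_one_le_exp (c * x ^ 2 * t)
    linarith
  have key : x ^ 2 * Real.exp (-(c * x ^ 2 * t)) * (c * t) ≤ 1 := by
    calc x ^ 2 * Real.exp (-(c * x ^ 2 * t)) * (c * t)
        = (c * x ^ 2 * t) * Real.exp (-(c * x ^ 2 * t)) := by ring
      _ ≤ Real.exp (c * x ^ 2 * t) * Real.exp (-(c * x ^ 2 * t)) := by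
          gcongr
      _ = 1 := by rw [← Real.exp_add, add_neg_cancel, Real.exp_zero]
  rwa [le_div_iff₀ (by positivity)]

/-- `x e^{-c x² t} ≤ √(1/(ct))` for `x ≥ 0`, `c, t > 0`. [folklore] -/
theorem mul_exp_neg_le {x c t : ℝ} (hx : 0 ≤ x) (hc : 0 < c) (ht : 0 < t) :
    x * Real.exp (-(c * x ^ 2 * t)) ≤ Real.sqrt (1 / (c * t)) := by
  have h1 : (x * Real.exp (-(c * x ^ 2 * t))) ^ 2 ≤ 1 / (c * t) := by
    have h2 : Real.exp (-(c * x ^ 2 * t)) ≤ 1 := by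
      rw [Real.exp_le_one_iff, neg_nonpos]; positivity
    have h3 : 0 ≤ Real.exp (-(c * x ^ 2 * t)) := (Real.exp_pos _).le
    calc (x * Real.exp (-(c * x ^ 2 * t))) ^ 2
        = x ^ 2 * Real.exp (-(c * x ^ 2 * t)) * Real.exp (-(c * x ^ 2 * t)) := by ring
      _ ≤ x ^ 2 * Real.exp (-(c * x ^ 2 * t)) * 1 := by gcongr
      _ ≤ 1 / (c * t) := by rw [mul_one]; exact sq_mul_exp_neg_le hc ht
  calc x * Real.exp (-(c * x ^ 2 * t)) = Real.sqrt ((x * Real.exp (-(c * x ^ 2 * t))) ^ 2) :=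
        (Real.sqrt_sq (by positivity)).symm
    _ ≤ Real.sqrt (1 / (c * t)) := Real.sqrt_le_sqrt h1

/-- Summability of `∑ₖ ε_k N_k e^{-cN_k²t}` for summable weights `ε_k ≥ 0`, `t > 0`. [folklore] -/
theorem summable_eps_mul_mul_exp_neg (hε : ∀ k, 0 ≤ ε k) (hεs : Summable ε) (hN : ∀ k, 0 ≤ N k)
    {c t : ℝ} (hc : 0 < c) (ht : 0 < t) :
    Summable fun k => ε k * N k * Real.exp (-(c * N k ^ 2 * t)) := by
  refine Summable.of_nonneg_of_le (fun k => by have := hε k; have := hN k; positivity)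
    (fun k => ?_) (hεs.mul_right (Real.sqrt (1 / (c * t))))
  have h := mul_exp_neg_le (hN k) hc ht
  have hεk := hε k
  calc ε k * N k * Real.exp (-(c * N k ^ 2 * t)) = ε k * (N k * Real.exp (-(c * N k ^ 2 * t))) := by
        ring
    _ ≤ ε k * Real.sqrt (1 / (c * t)) := by gcongr

/-- Summability of `∑ₖ ε_k N_k² e^{-cN_k²t}` for summable weights `ε_k ≥ 0`, `t > 0`. [folklore] -/
theorem summable_eps_mul_sq_mul_exp_neg (hε : ∀ k, 0 ≤ ε k) (hεs : Summable ε)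
    {c t : ℝ} (hc : 0 < c) (ht : 0 < t) :
    Summable fun k => ε k * N k ^ 2 * Real.exp (-(c * N k ^ 2 * t)) := by
  refine Summable.of_nonneg_of_le (fun k => by have := hε k; positivity)
    (fun k => ?_) (hεs.mul_right (1 / (c * t)))
  have h := sq_mul_exp_neg_le (x := N k) hc ht
  have hεk := hε k
  calc ε k * N k ^ 2 * Real.exp (-(c * N k ^ 2 * t))
      = ε k * (N k ^ 2 * Real.exp (-(c * N k ^ 2 * t))) := by ring
    _ ≤ ε k * (1 / (c * t)) := by gcongr

/-- **Cauchy–Schwarz in the scale index**: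
`(∑ₖ ε_k N_k e^{-cN_k²t})² ≤ (∑ₖ ε_k) · ∑ₖ ε_k N_k² e^{-2cN_k²t}` (`ε_k ≥ 0` summable, `t > 0`).
[folklore] -/
theorem tsum_eps_mul_mul_exp_neg_sq_le (hε : ∀ k, 0 ≤ ε k) (hεs : Summable ε) (hN : ∀ k, 0 ≤ N k)
    {c t : ℝ} (hc : 0 < c) (ht : 0 < t) :
    (∑' k, ε k * N k * Real.exp (-(c * N k ^ 2 * t))) ^ 2 ≤
      (∑' k, ε k) * ∑' k, ε k * N k ^ 2 * Real.exp (-(2 * c * N k ^ 2 * t)) := by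
  set f : ℕ → ℝ := fun k => Real.sqrt (ε k) with hf
  set g : ℕ → ℝ := fun k => Real.sqrt (ε k) * (N k * Real.exp (-(c * N k ^ 2 * t))) with hg
  have hf0 : ∀ k, 0 ≤ f k := fun k => Real.sqrt_nonneg _
  have hg0 : ∀ k, 0 ≤ g k := fun k => by have := hN k; simp only [hg]; positivity
  have hf2 : ∀ k, f k ^ (2 : ℝ) = ε k := fun k => by rw [Real.rpow_two, hf, Real.sq_sqrt (hε k)]
  have hg2 : ∀ k, g k ^ (2 : ℝ) = ε k * N k ^ 2 * Real.exp (-(2 * c * N k ^ 2 * t)) := by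
    intro k
    rw [Real.rpow_two, hg]
    dsimp only
    rw [mul_pow, Real.sq_sqrt (hε k), mul_pow, sq (Real.exp _), ← Real.exp_add]
    ring_nf
  have hfg : ∀ k, f k * g k = ε k * N k * Real.exp (-(c * N k ^ 2 * t)) := by
    intro k
    simp only [hf, hg]
    rw [← mul_assoc, Real.mul_self_sqrt (hε k)]
    ring
  have hfs : Summable fun k => f k ^ (2 : ℝ) := by
    simp_rw [hf2]; exact hεs
  have hgs : Summable fun k => g k ^ (2 : ℝ) := by
    simp_rw [hg2]
    exact summable_eps_mul_sq_mul_exp_neg hε hεs (by positivity) ht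
  have h := Real.inner_le_Lp_mul_Lq_tsum_of_nonneg Real.HolderConjugate.two_two hf0 hg0 hfs hgs
  simp_rw [hfg, hf2, hg2] at h
  have hA : 0 ≤ ∑' k, ε k := tsum_nonneg hε
  have hB : 0 ≤ ∑' k, ε k * N k ^ 2 * Real.exp (-(2 * c * N k ^ 2 * t)) :=
    tsum_nonneg fun k => by have := hε k; positivity
  have hL : 0 ≤ ∑' k, ε k * N k * Real.exp (-(c * N k ^ 2 * t)) :=
    tsum_nonneg fun k => by have := hε k; have := hN k; positivity
  calc (∑' k, ε k * N k * Real.exp (-(c * N k ^ 2 * t))) ^ 2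
      ≤ ((∑' k, ε k) ^ (1 / (2 : ℝ)) *
          (∑' k, ε k * N k ^ 2 * Real.exp (-(2 * c * N k ^ 2 * t))) ^ (1 / (2 : ℝ))) ^ 2 :=
        pow_le_pow_left₀ hL h 2
    _ = (∑' k, ε k) * ∑' k, ε k * N k ^ 2 * Real.exp (-(2 * c * N k ^ 2 * t)) := by
        rw [← Real.sqrt_eq_rpow, ← Real.sqrt_eq_rpow, mul_pow, Real.sq_sqrt hA, Real.sq_sqrt hB]

/-- `∫⁻_{(a,∞)} e^{-γt} dt = e^{-γa}/γ` for `γ > 0`. [folklore] -/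
theorem lintegral_Ioi_exp_neg_eq {a γ : ℝ} (hγ : 0 < γ) :
    ∫⁻ t in Ioi a, ENNReal.ofReal (Real.exp (-(γ * t))) =
      ENNReal.ofReal (Real.exp (-(γ * a)) / γ) := by
  have hγ' : -γ < 0 := neg_lt_zero.2 hγ
  have hfun : (fun t : ℝ => Real.exp (-(γ * t))) = fun t => Real.exp (-γ * t) := by
    ext t; ring_nf
  rw [← ofReal_integral_eq_lintegral_ofReal]
  · rw [hfun, integral_exp_mul_Ioi hγ' a]
    congr 1
    rw [neg_div, div_neg, neg_neg, neg_mul]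
  · rw [hfun]
    exact integrableOn_exp_mul_Ioi hγ' a
  · exact ae_of_all _ fun t => (Real.exp_pos _).le

/-- **`∫₀^∞ (∑ₖ ε_k N_k e^{-cN_k²t})² dt ≤ (∑ₖ ε_k)²/(2c)`** for summable weights `ε_k ≥ 0` and
ANY positive scales `N_k` (Cauchy–Schwarz in `k`, Tonelli, `∫₀^∞ N_k² e^{-2cN_k²t} dt = 1/(2c)`):
the mechanism of "`‖v_k‖_{L²_t L^p_x} ≲ N_{1,k+1}^{-α} + 2^{-k/p}`; summing in `k` proves the claim".
[cite: CheskidovDaiPalasek2025, proof of Prop. 6.2 (last paragraph)] -/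
theorem lintegral_sq_tsum_le (hε : ∀ k, 0 ≤ ε k) (hεs : Summable ε) (hN : ∀ k, 0 < N k)
    {c : ℝ} (hc : 0 < c) :
    ∫⁻ t in Ioi (0 : ℝ), ENNReal.ofReal ((∑' k, ε k * N k * Real.exp (-(c * N k ^ 2 * t))) ^ 2) ≤
      ENNReal.ofReal ((∑' k, ε k) ^ 2 / (2 * c)) := by
  set S : ℝ := ∑' k, ε k with hS
  have hS0 : 0 ≤ S := tsum_nonneg hε
  have hmeas : ∀ k, Measurable fun t : ℝ =>
      ENNReal.ofReal (ε k * N k ^ 2 * Real.exp (-(2 * c * N k ^ 2 * t))) := fun k =>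
    ENNReal.measurable_ofReal.comp (by fun_prop)
  calc ∫⁻ t in Ioi (0 : ℝ), ENNReal.ofReal ((∑' k, ε k * N k * Real.exp (-(c * N k ^ 2 * t))) ^ 2)
      ≤ ∫⁻ t in Ioi (0 : ℝ), ENNReal.ofReal S *
          ∑' k, ENNReal.ofReal (ε k * N k ^ 2 * Real.exp (-(2 * c * N k ^ 2 * t))) := by
        refine setLIntegral_mono' measurableSet_Ioi fun t ht => ?_
        have ht0 : 0 < t := ht
        rw [← ENNReal.ofReal_tsum_of_nonneg (fun k => by have := hε k; positivity)
          (summable_eps_mul_sq_mul_exp_neg hε hεs (by positivity) ht0), ← ENNReal.ofReal_mul hS0]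
        exact ENNReal.ofReal_le_ofReal
          (tsum_eps_mul_mul_exp_neg_sq_le hε hεs (fun k => (hN k).le) hc ht0)
    _ = ENNReal.ofReal S *
          ∑' k, ∫⁻ t in Ioi (0 : ℝ), ENNReal.ofReal (ε k * N k ^ 2 * Real.exp (-(2 * c * N k ^ 2 * t))) := by
        rw [lintegral_const_mul' _ _ ENNReal.ofReal_ne_top, lintegral_tsum fun k => (hmeas k).aemeasurable]
    _ = ENNReal.ofReal S * ∑' k, ENNReal.ofReal (ε k / (2 * c)) := by
        congr 1
        refine tsum_congr fun k => ?_
        have hNk := hN k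
        have hγ : 0 < 2 * c * N k ^ 2 := by positivity
        have h1 : ∀ t, ENNReal.ofReal (ε k * N k ^ 2 * Real.exp (-(2 * c * N k ^ 2 * t))) =
            ENNReal.ofReal (ε k * N k ^ 2) * ENNReal.ofReal (Real.exp (-(2 * c * N k ^ 2 * t))) :=
          fun t => by rw [← ENNReal.ofReal_mul (by have := hε k; positivity)]
        have hm : Measurable fun t : ℝ => ENNReal.ofReal (Real.exp (-(2 * c * N k ^ 2 * t))) :=
          ENNReal.measurable_ofReal.comp (by fun_prop)
        simp_rw [h1]
        rw [lintegral_const_mul _ hm, lintegral_Ioi_exp_neg_eq hγ, mul_zero, neg_zero, Real.exp_zero,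
          ← ENNReal.ofReal_mul (by have := hε k; positivity)]
        congr 1
        field_simp
    _ = ENNReal.ofReal S * ENNReal.ofReal (S / (2 * c)) := by
        rw [← ENNReal.ofReal_tsum_of_nonneg (fun k => by have := hε k; positivity)
          (hεs.div_const _), tsum_div_const]
    _ = ENNReal.ofReal (S ^ 2 / (2 * c)) := by
        rw [← ENNReal.ofReal_mul hS0]
        congr 1
        ring

/-- Continuity of `t ↦ ∑ₖ ε_k N_k e^{-cN_k²t}` on `[t₁, t₂]`, `t₁ > 0` (uniform convergence:
termwise domination by the summable values at `t₁`). [folklore] -/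
theorem continuousOn_tsum_eps_mul_mul_exp_neg (hε : ∀ k, 0 ≤ ε k) (hεs : Summable ε)
    (hN : ∀ k, 0 ≤ N k) {c : ℝ} (hc : 0 < c) {t₁ t₂ : ℝ} (ht₁ : 0 < t₁) :
    ContinuousOn (fun t => ∑' k, ε k * N k * Real.exp (-(c * N k ^ 2 * t))) (Icc t₁ t₂) := by
  refine continuousOn_tsum (fun k => ?_) (summable_eps_mul_mul_exp_neg hε hεs hN hc ht₁)
    fun k t ht => ?_
  · exact (continuous_const.mul (Real.continuous_exp.comp
      ((continuous_const.mul continuous_id).neg))).continuousOn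
  · have hεk := hε k
    have hNk := hN k
    rw [Real.norm_eq_abs, abs_of_nonneg (by positivity)]
    refine mul_le_mul_of_nonneg_left (Real.exp_le_exp.2 ?_) (by positivity)
    have : c * N k ^ 2 * t₁ ≤ c * N k ^ 2 * t := mul_le_mul_of_nonneg_left ht.1 (by positivity)
    linarith

/-- Continuity of `t ↦ ∑ₖ N_k² e^{-cN_k²t}` on `[t₁, t₂]`, `t₁ > 0`, for lacunary scales. [folklore] -/
theorem continuousOn_tsum_sq_mul_exp_neg_of_lacunary (hN : ∀ k, 0 < N k)
    (hlac : ∀ k, 2 * N k ≤ N (k + 1)) {c : ℝ} (hc : 0 < c) {t₁ t₂ : ℝ} (ht₁ : 0 < t₁) :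
    ContinuousOn (fun t => ∑' k, N k ^ 2 * Real.exp (-(c * N k ^ 2 * t))) (Icc t₁ t₂) := by
  have hsum := summable_rpow_mul_exp_neg_of_lacunary hN hlac two_pos hc ht₁
  simp_rw [Real.rpow_two] at hsum
  refine continuousOn_tsum (fun k => ?_) hsum fun k t ht => ?_
  · exact (continuous_const.mul (Real.continuous_exp.comp
      ((continuous_const.mul continuous_id).neg))).continuousOn
  · have hNk := hN k
    rw [Real.norm_eq_abs, abs_of_nonneg (by positivity)]
    refine mul_le_mul_of_nonneg_left (Real.exp_le_exp.2 ?_) (by positivity)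
    have : c * N k ^ 2 * t₁ ≤ c * N k ^ 2 * t := mul_le_mul_of_nonneg_left ht.1 (by positivity)
    linarith

/-- From continuity on every `[t₁, τ]`, `t₁ > 0`, to continuity on `(0, τ)`. [folklore] -/
theorem continuousOn_Ioo_of_forall_Icc {f : ℝ → ℝ} {τ : ℝ}
    (h : ∀ t₁, 0 < t₁ → ContinuousOn f (Icc t₁ τ)) : ContinuousOn f (Ioo 0 τ) := by
  intro t ht
  have h1 : ContinuousWithinAt f (Icc (t / 2) τ) t :=
    h (t / 2) (by linarith [ht.1]) t ⟨by linarith [ht.1], ht.2.le⟩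
  refine h1.mono_of_mem_nhdsWithin ?_
  refine mem_nhdsWithin.2 ⟨Ioi (t / 2), isOpen_Ioi, by simp only [mem_Ioi]; linarith [ht.1], ?_⟩
  rintro s ⟨hs1, hs2⟩
  exact ⟨le_of_lt hs1, hs2.2.le⟩

end TimeL2

/-! ## Mixed-norm bookkeeping on `𝕋ⁿ` -/

section MixedNorm

variable {n : ℕ}

/-- Continuous fields on the torus have finite `L^p` norms. [folklore] -/
theorem eLpNorm_lt_top_of_continuous {p : ℝ≥0∞}
    {u : UnitAddTorus (Fin n) → EuclideanSpace ℝ (Fin n)} (hu : Continuous u) :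
    eLpNorm u p volume < ⊤ := by
  obtain ⟨M, hM⟩ := isCompact_univ.exists_bound_of_continuousOn hu.continuousOn
  exact ((memLp_top_of_bound hu.aestronglyMeasurable M
    (ae_of_all _ fun x => hM x (mem_univ x))).mono_exponent le_top).eLpNorm_lt_top

/-- **Slice `L^p` bound of a three-term sum** `‖f + g + h‖_{L^p(𝕋ⁿ)} ≤ M_f + ‖g‖_{L^p} + M_h` for
continuous fields with `‖f‖ ≤ M_f`, `‖h‖ ≤ M_h` pointwise, `1 ≤ p` (Minkowski and `|𝕋ⁿ| = 1`).
[folklore] -/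
theorem toReal_eLpNorm_add_three_le {p : ℝ≥0∞} (hp : 1 ≤ p)
    {f g h : UnitAddTorus (Fin n) → EuclideanSpace ℝ (Fin n)} (hf : Continuous f)
    (hg : Continuous g) (hh : Continuous h) {Mf Mh : ℝ} (hMf : ∀ x, ‖f x‖ ≤ Mf)
    (hMh : ∀ x, ‖h x‖ ≤ Mh) :
    (eLpNorm (fun x => f x + g x + h x) p volume).toReal ≤
      Mf + (eLpNorm g p volume).toReal + Mh := by
  have hMf0 : 0 ≤ Mf := (norm_nonneg _).trans (hMf 0)
  have hMh0 : 0 ≤ Mh := (norm_nonneg _).trans (hMh 0)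
  have hf' : eLpNorm f p volume ≤ ENNReal.ofReal Mf := by
    refine (eLpNorm_le_of_ae_bound (ae_of_all _ hMf)).trans ?_
    simp
  have hh' : eLpNorm h p volume ≤ ENNReal.ofReal Mh := by
    refine (eLpNorm_le_of_ae_bound (ae_of_all _ hMh)).trans ?_
    simp
  have hfg_m : AEStronglyMeasurable (f + g) volume := (hf.add hg).aestronglyMeasurable
  have h1 : eLpNorm ((f + g) + h) p volume ≤ eLpNorm (f + g) p volume + eLpNorm h p volume :=
    eLpNorm_add_le hfg_m hh.aestronglyMeasurable hp
  have h2 : eLpNorm (f + g) p volume ≤ eLpNorm f p volume + eLpNorm g p volume :=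
    eLpNorm_add_le hf.aestronglyMeasurable hg.aestronglyMeasurable hp
  have h3 : (fun x => f x + g x + h x) = (f + g) + h := by
    funext x
    simp only [Pi.add_apply]
  have hsum : eLpNorm (fun x => f x + g x + h x) p volume ≤
      eLpNorm f p volume + eLpNorm g p volume + eLpNorm h p volume := by
    rw [h3]
    exact h1.trans (add_le_add h2 le_rfl)
  have hfT : eLpNorm f p volume ≠ ⊤ := (eLpNorm_lt_top_of_continuous (p := p) hf).ne
  have hgT : eLpNorm g p volume ≠ ⊤ := (eLpNorm_lt_top_of_continuous (p := p) hg).ne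
  have hhT : eLpNorm h p volume ≠ ⊤ := (eLpNorm_lt_top_of_continuous (p := p) hh).ne
  have hfgT : eLpNorm f p volume + eLpNorm g p volume ≠ ⊤ := ENNReal.add_ne_top.2 ⟨hfT, hgT⟩
  have hfghT : eLpNorm f p volume + eLpNorm g p volume + eLpNorm h p volume ≠ ⊤ :=
    ENNReal.add_ne_top.2 ⟨hfgT, hhT⟩
  have h1 : (eLpNorm (fun x => f x + g x + h x) p volume).toReal ≤
      (eLpNorm f p volume + eLpNorm g p volume + eLpNorm h p volume).toReal :=
    ENNReal.toReal_mono hfghT hsum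
  have h2 : (eLpNorm f p volume + eLpNorm g p volume + eLpNorm h p volume).toReal =
      (eLpNorm f p volume).toReal + (eLpNorm g p volume).toReal + (eLpNorm h p volume).toReal := by
    rw [ENNReal.toReal_add hfgT hhT, ENNReal.toReal_add hfT hgT]
  have h3 : (eLpNorm f p volume).toReal ≤ Mf := ENNReal.toReal_le_of_le_ofReal hMf0 hf'
  have h4 : (eLpNorm h p volume).toReal ≤ Mh := ENNReal.toReal_le_of_le_ofReal hMh0 hh'
  linarith

/-- **`u ∈ L²(0,τ; L^p(𝕋ⁿ))` from a square-integrable majorant of the slice norms**: if the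
slices `u(t)`, `t ∈ (0, τ)`, are continuous with `‖u(t)‖_{L^p} ≤ Φ(t)`, `Φ` measurable with
`∫₀^τ Φ² < ∞`, then `MemLqLp 2 p u (0, τ)`. [folklore] -/
theorem memLqLp_two_of_le {p : ℝ≥0∞} {τ : ℝ}
    {u : ℝ → UnitAddTorus (Fin n) → EuclideanSpace ℝ (Fin n)} {Φ : ℝ → ℝ}
    (hc : ∀ t ∈ Ioo 0 τ, Continuous (u t))
    (hle : ∀ t ∈ Ioo 0 τ, (eLpNorm (u t) p volume).toReal ≤ Φ t)
    (hΦm : AEStronglyMeasurable Φ (volume.restrict (Ioo 0 τ)))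
    (hΦ : IntegrableOn (fun t => Φ t ^ 2) (Ioo 0 τ)) :
    FluidPDE.Torus.MemLqLp 2 p u (Ioo 0 τ) := by
  have hmem : ∀ᵐ t ∂(volume.restrict (Ioo 0 τ)), MemLp (u t) p volume := by
    filter_upwards [ae_restrict_mem measurableSet_Ioo] with t ht
    obtain ⟨M, hM⟩ := isCompact_univ.exists_bound_of_continuousOn (hc t ht).continuousOn
    exact (memLp_top_of_bound (hc t ht).aestronglyMeasurable M
      (ae_of_all _ fun x => hM x (mem_univ x))).mono_exponent le_top
  refine ⟨hmem, ?_⟩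
  change eLpNorm (fun t => (eLpNorm (u t) p volume).toReal) 2 (volume.restrict (Ioo 0 τ)) < ⊤
  have hmono : eLpNorm (fun t => (eLpNorm (u t) p volume).toReal) 2 (volume.restrict (Ioo 0 τ)) ≤
      eLpNorm Φ 2 (volume.restrict (Ioo 0 τ)) := by
    refine eLpNorm_mono_ae ?_
    filter_upwards [ae_restrict_mem measurableSet_Ioo] with t ht
    have h0 : 0 ≤ (eLpNorm (u t) p volume).toReal := ENNReal.toReal_nonneg
    rw [Real.norm_eq_abs, Real.norm_eq_abs, abs_of_nonneg h0, abs_of_nonneg (h0.trans (hle t ht))]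
    exact hle t ht
  exact lt_of_le_of_lt hmono ((memLp_two_iff_integrable_sq hΦm).2 hΦ).eLpNorm_lt_top

/-- **`u ∈ L²((0,τ) × 𝕋ⁿ)` from a square-integrable majorant of the slice `L²` norms.**
[folklore] -/
theorem lintegral_lintegral_sq_lt_top_of_le {τ : ℝ}
    {u : ℝ → UnitAddTorus (Fin n) → EuclideanSpace ℝ (Fin n)} {Φ : ℝ → ℝ}
    (hc : ∀ t ∈ Ioo 0 τ, Continuous (u t))
    (hle : ∀ t ∈ Ioo 0 τ, (eLpNorm (u t) 2 volume).toReal ≤ Φ t)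
    (hΦ : IntegrableOn (fun t => Φ t ^ 2) (Ioo 0 τ)) :
    ∫⁻ t in Ioo 0 τ, ∫⁻ x, ‖u t x‖ₑ ^ 2 < ⊤ := by
  have hpt : ∀ t ∈ Ioo 0 τ, ∫⁻ x, ‖u t x‖ₑ ^ 2 ≤ ENNReal.ofReal (Φ t ^ 2) := by
    intro t ht
    have hfin : eLpNorm (u t) 2 volume < ⊤ := eLpNorm_lt_top_of_continuous (hc t ht)
    have h1 : ∫⁻ x, ‖u t x‖ₑ ^ 2 = eLpNorm (u t) 2 volume ^ 2 := by
      have h2 : ∀ y : ℝ≥0∞, y ^ 2 = y ^ (2 : ℝ) := fun y => by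
        rw [show (2 : ℝ) = ((2 : ℕ) : ℝ) by norm_num, ENNReal.rpow_natCast]
      simp_rw [h2]
      rw [eLpNorm_eq_eLpNorm' two_ne_zero ENNReal.ofNat_ne_top, ENNReal.toReal_ofNat,
        lintegral_rpow_enorm_eq_rpow_eLpNorm' two_pos]
    have h0 : 0 ≤ (eLpNorm (u t) 2 volume).toReal := ENNReal.toReal_nonneg
    have hΦ0 : 0 ≤ Φ t := h0.trans (hle t ht)
    have h3 : eLpNorm (u t) 2 volume ≤ ENNReal.ofReal (Φ t) :=
      (ENNReal.le_ofReal_iff_toReal_le hfin.ne hΦ0).2 (hle t ht)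
    rw [h1, ENNReal.ofReal_pow hΦ0]
    gcongr
  calc ∫⁻ t in Ioo 0 τ, ∫⁻ x, ‖u t x‖ₑ ^ 2 ≤ ∫⁻ t in Ioo 0 τ, ENNReal.ofReal (Φ t ^ 2) :=
        setLIntegral_mono' measurableSet_Ioo hpt
    _ < ⊤ := hΦ.lintegral_lt_top

end MixedNorm

/-! ## Hypothesis `h₂` from block-type bounds -/

section Blocks

/-- **Prop. 4.3 / Prop. 5.3 / Prop. 6.2 ⟹ hypothesis `h₂`.** Hypothesis `h₃` asks, for every
classical background `(U, P)` on `[0, T] × 𝕋ⁿ` (`T ≤ T₁(n)`) and `T_* ∈ [0, T)`, for fields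
`v, w, q` on `(0, T - T_*]` with: `u = U(· + T_*) + v + w` a classical solution (Prop. 5.3,
§5); `v` jointly smooth (§3.3: a locally uniformly convergent series of smooth fields); the
BLOCK-TYPE BOUNDS of `v` over double-exponential scales `N_k` (`N_{k+1} ≥ 2N_k`,
`N_k ≥ exp(exp(κ(k+1)))`, §3.1) — pointwise `‖v(t,x)‖ ≤ E(t^{α-1/2}+1) + C∑ₖ N_k e^{-cN_k²t}`,
`‖∇v(t,x)‖ ≤ E(t^{α-1}+1) + C∑ₖ N_k² e^{-cN_k²t}` and in `L^p`, `1 ≤ p < ∞`,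
`‖v(t)‖_{L^p} ≤ E(t^{α-1/2}+1) + C∑ₖ 2^{-k/p} N_k e^{-cN_k²t}` (display (4.20) in the proof of
Prop. 4.3 with Prop. 4.2, `n = 0, 1`, summed over `k`; the volume factor `|Ω_k|^{1/p} ≤ 2^{-k/p}` is
Lemma 3.1); the corrector bounds `‖w(t)‖ ≤ δt^{-β₀}`, `‖∇w(t)‖ ≤ δt^{-β₁}`, `β₀ < 1/2`, `β₁ < 1`
(Prop. 5.3: `w ∈ B_X(0,δ)`); the lower bound `‖v(tₖ, xₖ)‖ ≥ c₀ tₖ^{-1/2}` along `tₖ → 0⁺`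
(proof of Thm. 1.1); and the `𝒟'`-limits `v(t), w(t) ⇀ 0` as `t → 0⁺` (Prop. 6.2 / §5). It
implies `h₂` of `construction_of_decomposition`: the Type-I bounds of `v` by the lacunary
Gaussian sums `∑ N_k^a e^{-cN_k²t} ≤ C_a t^{-a/2}` (Prop. 4.3 (v-pointwise-bounds)); the Orlicz
bounds (5) for `v` by `integrableOn_orliczF/H_of_le_tsum_lacunary` and the domination
`F(a+b) ≤ 4a² + 4F(b)`, `H(a+b) ≤ 2a + 2H(b)`; `u ∈ L²_{t,x} ∩ L²_tL^p_x` by Minkowski on the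
slices, `∫₀^∞(∑ₖ 2^{-k/p}N_k e^{-cN_k²t})² dt ≤ (∑ₖ 2^{-k/p})²/(2c)` (`lintegral_sq_tsum_le`) and
`∫₀^τ (t^{2α-1} + t^{-2β₀}) dt < ∞` (Prop. 6.2, last paragraph of its proof).
[cite: CheskidovDaiPalasek2025, Prop. 4.3 with (4.20), Prop. 5.3, Prop. 6.2, proof of Thm. 1.1] -/
theorem construction_of_blockBounds
    (h₃ : ∀ (n : ℕ), 2 ≤ n → ∃ T₁ : ℝ, 0 < T₁ ∧ ∀ (T : ℝ), 0 < T → T ≤ T₁ →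
      ∀ (U : ℝ → UnitAddTorus (Fin n) → EuclideanSpace ℝ (Fin n))
        (P : ℝ → UnitAddTorus (Fin n) → ℝ),
        FunctionSpaces.Torus.IsClassicalNSSolutionOn (Icc 0 T) 1 0 U P →
        ∀ Ts : ℝ, 0 ≤ Ts → Ts < T →
          ∃ (v w : ℝ → UnitAddTorus (Fin n) → EuclideanSpace ℝ (Fin n))
            (q : ℝ → UnitAddTorus (Fin n) → ℝ),
            FunctionSpaces.Torus.IsClassicalNSSolutionOn (Ioc 0 (T - Ts)) 1 0
              (fun t x => U (t + Ts) x + v t x + w t x) q ∧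
            IsSmoothSpaceTimeOn (Ioc 0 (T - Ts)) v ∧
            (∃ (N : ℕ → ℝ) (κ c α C E : ℝ), (∀ k, 0 < N k) ∧ (∀ k, 2 * N k ≤ N (k + 1)) ∧ 0 < κ ∧
              (∀ k : ℕ, Real.exp (Real.exp (κ * (k + 1))) ≤ N k) ∧ 0 < c ∧ 0 < α ∧
              (∀ t ∈ Ioc 0 (T - Ts), ∀ x,
                ‖v t x‖ ≤ E * (t ^ (α - 1 / 2) + 1) + C * ∑' k, N k * Real.exp (-(c * N k ^ 2 * t)) ∧
                ‖FunctionSpaces.Torus.fderiv (v t) x‖ ≤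
                  E * (t ^ (α - 1) + 1) + C * ∑' k, N k ^ 2 * Real.exp (-(c * N k ^ 2 * t))) ∧
              (∀ p : ℝ, 1 ≤ p → ∀ t ∈ Ioc 0 (T - Ts),
                (eLpNorm (v t) (ENNReal.ofReal p) volume).toReal ≤
                  E * (t ^ (α - 1 / 2) + 1) +
                    C * ∑' k : ℕ, (2 : ℝ) ^ (-((k : ℝ) / p)) * N k * Real.exp (-(c * N k ^ 2 * t)))) ∧
            (∃ δ β₀ β₁ : ℝ, β₀ < 1 / 2 ∧ β₁ < 1 ∧ ∀ t ∈ Ioc 0 (T - Ts), ∀ x,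
              ‖w t x‖ ≤ δ * t ^ (-β₀) ∧ ‖FunctionSpaces.Torus.fderiv (w t) x‖ ≤ δ * t ^ (-β₁)) ∧
            (∃ c₀ : ℝ, 0 < c₀ ∧ ∃ s : ℕ → ℝ, (∀ k, 0 < s k ∧ s k ≤ T - Ts) ∧
              Tendsto s atTop (𝓝 0) ∧ ∀ k, ∃ x, c₀ / Real.sqrt (s k) ≤ ‖v (s k) x‖) ∧
            (∀ φ : UnitAddTorus (Fin n) → EuclideanSpace ℝ (Fin n), IsSmooth φ →
              Tendsto (fun t => ∫ x, ⟪v t x, φ x⟫_ℝ) (𝓝[>] 0) (𝓝 0)) ∧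
            (∀ φ : UnitAddTorus (Fin n) → EuclideanSpace ℝ (Fin n), IsSmooth φ →
              Tendsto (fun t => ∫ x, ⟪w t x, φ x⟫_ℝ) (𝓝[>] 0) (𝓝 0))) :
    ∀ (n : ℕ), 2 ≤ n → ∃ T₁ : ℝ, 0 < T₁ ∧ ∀ (T : ℝ), 0 < T → T ≤ T₁ →
      ∀ (U : ℝ → UnitAddTorus (Fin n) → EuclideanSpace ℝ (Fin n))
        (P : ℝ → UnitAddTorus (Fin n) → ℝ),
        FunctionSpaces.Torus.IsClassicalNSSolutionOn (Icc 0 T) 1 0 U P →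
        ∀ Ts : ℝ, 0 ≤ Ts → Ts < T →
          ∃ (v w : ℝ → UnitAddTorus (Fin n) → EuclideanSpace ℝ (Fin n))
            (q : ℝ → UnitAddTorus (Fin n) → ℝ),
            FunctionSpaces.Torus.IsClassicalNSSolutionOn (Ioc 0 (T - Ts)) 1 0
              (fun t x => U (t + Ts) x + v t x + w t x) q ∧
            (∀ t ∈ Ioc 0 (T - Ts), IsSmooth (v t)) ∧
            (∃ K : ℝ, ∀ t ∈ Ioc 0 (T - Ts), ∀ x, ‖v t x‖ ≤ K / Real.sqrt t ∧
              ‖FunctionSpaces.Torus.fderiv (v t) x‖ ≤ K / t) ∧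
            (∃ δ β₀ β₁ : ℝ, β₀ < 1 / 2 ∧ β₁ < 1 ∧ ∀ t ∈ Ioc 0 (T - Ts), ∀ x,
              ‖w t x‖ ≤ δ * t ^ (-β₀) ∧ ‖FunctionSpaces.Torus.fderiv (w t) x‖ ≤ δ * t ^ (-β₁)) ∧
            (∃ c₀ : ℝ, 0 < c₀ ∧ ∃ s : ℕ → ℝ, (∀ k, 0 < s k ∧ s k ≤ T - Ts) ∧
              Tendsto s atTop (𝓝 0) ∧ ∀ k, ∃ x, c₀ / Real.sqrt (s k) ≤ ‖v (s k) x‖) ∧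
            (∀ φ : UnitAddTorus (Fin n) → EuclideanSpace ℝ (Fin n), IsSmooth φ →
              Tendsto (fun t => ∫ x, ⟪v t x, φ x⟫_ℝ) (𝓝[>] 0) (𝓝 0)) ∧
            (∀ φ : UnitAddTorus (Fin n) → EuclideanSpace ℝ (Fin n), IsSmooth φ →
              Tendsto (fun t => ∫ x, ⟪w t x, φ x⟫_ℝ) (𝓝[>] 0) (𝓝 0)) ∧
            (∫⁻ t in Ioo 0 (T - Ts), ∫⁻ x, ‖U (t + Ts) x + v t x + w t x‖ₑ ^ 2 < ⊤) ∧
            (∀ p : ℝ, 1 ≤ p → FluidPDE.Torus.MemLqLp 2 (ENNReal.ofReal p)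
              (fun t x => U (t + Ts) x + v t x + w t x) (Ioo 0 (T - Ts))) ∧
            IntegrableOn (fun t : ℝ => (⨆ x, ‖v t x‖) ^ 2 /
              (1 + Real.log (Real.log (Real.exp 1 + ⨆ x, ‖v t x‖)) ^ (2 : ℝ))) (Ioo 0 (T - Ts)) ∧
            IntegrableOn (fun t : ℝ => (⨆ x, ‖FunctionSpaces.Torus.fderiv (v t) x‖) /
              (1 + Real.log (Real.log (Real.exp 1 +
                ⨆ x, ‖FunctionSpaces.Torus.fderiv (v t) x‖)) ^ (2 : ℝ))) (Ioo 0 (T - Ts)) := by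
  intro n hn
  obtain ⟨T₁, hT₁, h⟩ := h₃ n hn
  refine ⟨T₁, hT₁, fun T hT hTT₁ U P hU Ts hTs0 hTsT => ?_⟩
  obtain ⟨v, w, q, hcl, hvst, ⟨N, κ, c, α, C, E, hN, hlac, hκ, hgrow, hc, hα, hpt, hLp⟩,
    ⟨δ, β₀, β₁, hβ₀, hβ₁, hwb⟩, hlow, hvlim, hwlim⟩ := h T hT hTT₁ U P hU Ts hTs0 hTsT
  set τ : ℝ := T - Ts with hτ_def
  have hτ : 0 < τ := sub_pos.2 hTsT
  set u : ℝ → UnitAddTorus (Fin n) → EuclideanSpace ℝ (Fin n) :=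
    fun t x => U (t + Ts) x + v t x + w t x with hu_def
  -- nonnegative versions of the constants
  set C' : ℝ := max C 0 with hC'
  set E' : ℝ := max E 0 with hE'
  have hC'0 : 0 ≤ C' := le_max_right _ _
  have hE'0 : 0 ≤ E' := le_max_right _ _
  -- the lacunary Gaussian sums
  obtain ⟨C₁, hC₁0, hC₁⟩ := exists_tsum_rpow_mul_exp_neg_le_of_lacunary (a := 1) one_pos hc
  obtain ⟨C₂, hC₂0, hC₂⟩ := exists_tsum_rpow_mul_exp_neg_le_of_lacunary (a := 2) two_pos hc
  set g : ℝ → ℝ := fun t => ∑' k, N k * Real.exp (-(c * N k ^ 2 * t)) with hg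
  set g₂ : ℝ → ℝ := fun t => ∑' k, N k ^ 2 * Real.exp (-(c * N k ^ 2 * t)) with hg₂
  have hg0 : ∀ t, 0 ≤ g t := fun t => tsum_nonneg fun k => by have := hN k; positivity
  have hg₂0 : ∀ t, 0 ≤ g₂ t := fun t => tsum_nonneg fun k => by have := hN k; positivity
  have hgle : ∀ t, 0 < t → g t ≤ C₁ / Real.sqrt t := by
    intro t ht
    have h1 := hC₁ N hN hlac t ht
    simp_rw [Real.rpow_one] at h1
    have h2 : Real.exp (-(c / 2 * N 0 ^ 2 * t)) ≤ 1 := by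
      rw [Real.exp_le_one_iff, neg_nonpos]; have := hN 0; positivity
    have h3 : t ^ (-((1 : ℝ) / 2)) = 1 / Real.sqrt t := by
      rw [Real.rpow_neg ht.le, ← Real.sqrt_eq_rpow, one_div]
    calc g t ≤ C₁ * t ^ (-((1 : ℝ) / 2)) * Real.exp (-(c / 2 * N 0 ^ 2 * t)) := h1
      _ ≤ C₁ * t ^ (-((1 : ℝ) / 2)) * 1 := by gcongr
      _ = C₁ / Real.sqrt t := by rw [h3]; ring
  have hg₂le : ∀ t, 0 < t → g₂ t ≤ C₂ / t := by
    intro t ht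
    have h1 := hC₂ N hN hlac t ht
    simp_rw [Real.rpow_two] at h1
    have h2 : Real.exp (-(c / 2 * N 0 ^ 2 * t)) ≤ 1 := by
      rw [Real.exp_le_one_iff, neg_nonpos]; have := hN 0; positivity
    have h3 : t ^ (-((2 : ℝ) / 2)) = 1 / t := by
      rw [show (-((2 : ℝ) / 2)) = -1 by norm_num, Real.rpow_neg_one, one_div]
    calc g₂ t ≤ C₂ * t ^ (-((2 : ℝ) / 2)) * Real.exp (-(c / 2 * N 0 ^ 2 * t)) := h1
      _ ≤ C₂ * t ^ (-((2 : ℝ) / 2)) * 1 := by gcongr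
      _ = C₂ / t := by rw [h3]; ring
  -- the block bounds with nonnegative constants
  have hv1 : ∀ t ∈ Ioc 0 τ, ∀ x, ‖v t x‖ ≤ E' * (t ^ (α - 1 / 2) + 1) + C' * g t := by
    intro t ht x
    have hp0 : 0 ≤ t ^ (α - 1 / 2) + 1 := by have := Real.rpow_nonneg ht.1.le (α - 1 / 2); positivity
    calc ‖v t x‖ ≤ E * (t ^ (α - 1 / 2) + 1) + C * g t := (hpt t ht x).1
      _ ≤ E' * (t ^ (α - 1 / 2) + 1) + C' * g t :=
          add_le_add (mul_le_mul_of_nonneg_right (le_max_left _ _) hp0)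
            (mul_le_mul_of_nonneg_right (le_max_left _ _) (hg0 t))
  have hDv1 : ∀ t ∈ Ioc 0 τ, ∀ x, ‖FunctionSpaces.Torus.fderiv (v t) x‖ ≤
      E' * (t ^ (α - 1) + 1) + C' * g₂ t := by
    intro t ht x
    have hp0 : 0 ≤ t ^ (α - 1) + 1 := by have := Real.rpow_nonneg ht.1.le (α - 1); positivity
    calc ‖FunctionSpaces.Torus.fderiv (v t) x‖ ≤ E * (t ^ (α - 1) + 1) + C * g₂ t := (hpt t ht x).2
      _ ≤ E' * (t ^ (α - 1) + 1) + C' * g₂ t :=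
          add_le_add (mul_le_mul_of_nonneg_right (le_max_left _ _) hp0)
            (mul_le_mul_of_nonneg_right (le_max_left _ _) (hg₂0 t))
  -- smoothness of the slices
  have hvs : ∀ t ∈ Ioc 0 τ, IsSmooth (v t) := fun t ht => hvst.isSmooth_slice ht
  have hUsm : IsSmoothSpaceTimeOn (Icc 0 T) U := hU.smooth_velocity
  have husm : IsSmoothSpaceTimeOn (Ioc 0 τ) u := hcl.smooth_velocity
  have hmem : ∀ t ∈ Ioc 0 τ, t + Ts ∈ Icc 0 T := fun t ht =>
    ⟨by linarith [ht.1], by rw [hτ_def] at ht; linarith [ht.2]⟩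
  have hUts : ∀ t ∈ Ioc 0 τ, IsSmooth (U (t + Ts)) := fun t ht => hUsm.isSmooth_slice (hmem t ht)
  have hus : ∀ t ∈ Ioc 0 τ, IsSmooth (u t) := fun t ht => husm.isSmooth_slice ht
  have hws : ∀ t ∈ Ioc 0 τ, IsSmooth (w t) := by
    intro t ht
    have h : w t = fun x => u t x - U (t + Ts) x - v t x := by
      funext x; simp only [hu_def]; abel
    rw [h]
    exact ((hus t ht).sub (hUts t ht)).sub (hvs t ht)
  -- bound of the background
  obtain ⟨M₀, hM₀⟩ := hUsm.exists_norm_le_of_isCompact isCompact_Icc Subset.rfl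
  set M : ℝ := max M₀ 0 with hM_def
  have hM0 : 0 ≤ M := le_max_right _ _
  have hM : ∀ t ∈ Ioc 0 τ, ∀ x, ‖U (t + Ts) x‖ ≤ M := fun t ht x =>
    (hM₀ _ (hmem t ht) x).trans (le_max_left _ _)
  -- the corrector with `|δ|`
  have hwb' : ∀ t ∈ Ioc 0 τ, ∀ x, ‖w t x‖ ≤ |δ| * t ^ (-β₀) := fun t ht x =>
    (hwb t ht x).1.trans (mul_le_mul_of_nonneg_right (le_abs_self δ) (Real.rpow_nonneg ht.1.le _))
  -- continuity of the scale sums on `(0, τ)`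
  have hgc : ContinuousOn g (Ioo 0 τ) := continuousOn_Ioo_of_forall_Icc fun t₁ ht₁ =>
    continuousOn_tsum_mul_exp_neg_of_lacunary hN hlac hc ht₁
  have hg₂c : ContinuousOn g₂ (Ioo 0 τ) := continuousOn_Ioo_of_forall_Icc fun t₁ ht₁ =>
    continuousOn_tsum_sq_mul_exp_neg_of_lacunary hN hlac hc ht₁
  -- the square-integrable majorants of the slice `L^p` norms of `u` (Prop. 6.2)
  have hΦ : ∀ p : ℝ, 1 ≤ p → ∃ Φ : ℝ → ℝ,
      (∀ t ∈ Ioo 0 τ, (eLpNorm (u t) (ENNReal.ofReal p) volume).toReal ≤ Φ t) ∧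
      AEStronglyMeasurable Φ (volume.restrict (Ioo 0 τ)) ∧
      IntegrableOn (fun t => Φ t ^ 2) (Ioo 0 τ) := by
    intro p hp
    have hp0 : 0 < p := by linarith
    -- the weights `2^{-k/p}` (the volume factors `|Ω_k|^{1/p}`, Lemma 3.1)
    set ε : ℕ → ℝ := fun k => (2 : ℝ) ^ (-((k : ℝ) / p)) with hε
    have hε0 : ∀ k, 0 ≤ ε k := fun k => Real.rpow_nonneg (by norm_num) _
    have hεs : Summable ε := by
      have hr : (2 : ℝ) ^ (-(1 / p)) < 1 :=
        Real.rpow_lt_one_of_one_lt_of_neg (by norm_num) (by rw [neg_lt_zero]; positivity)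
      have hr0 : 0 ≤ (2 : ℝ) ^ (-(1 / p)) := Real.rpow_nonneg (by norm_num) _
      have heq : ε = fun k : ℕ => ((2 : ℝ) ^ (-(1 / p))) ^ k := by
        funext k
        rw [hε]
        dsimp only
        rw [← Real.rpow_natCast, ← Real.rpow_mul (by norm_num)]
        congr 1
        ring
      rw [heq]
      exact summable_geometric_of_lt_one hr0 hr
    set hh : ℝ → ℝ := fun t => ∑' k, ε k * N k * Real.exp (-(c * N k ^ 2 * t)) with hhh
    have hh0 : ∀ t, 0 ≤ hh t := fun t =>
      tsum_nonneg fun k => by have := hε0 k; have := hN k; positivity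
    have hhc : ContinuousOn hh (Ioo 0 τ) := continuousOn_Ioo_of_forall_Icc fun t₁ ht₁ =>
      continuousOn_tsum_eps_mul_mul_exp_neg hε0 hεs (fun k => (hN k).le) hc ht₁
    -- the majorant
    set Φ : ℝ → ℝ := fun t =>
      M + (E' * (t ^ (α - 1 / 2) + 1) + C' * hh t) + |δ| * t ^ (-β₀) with hΦdef
    have hc2 : ContinuousOn (fun t : ℝ => t ^ (α - 1 / 2)) (Ioo 0 τ) :=
      ContinuousOn.rpow_const continuousOn_id fun t ht => Or.inl ht.1.ne'
    have hc3 : ContinuousOn (fun t : ℝ => t ^ (-β₀)) (Ioo 0 τ) :=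
      ContinuousOn.rpow_const continuousOn_id fun t ht => Or.inl ht.1.ne'
    have hcΦ : ContinuousOn Φ (Ioo 0 τ) :=
      (continuousOn_const.add ((continuousOn_const.mul (hc2.add continuousOn_const)).add
        (continuousOn_const.mul hhc))).add (continuousOn_const.mul hc3)
    refine ⟨Φ, fun t ht => ?_, hcΦ.aestronglyMeasurable measurableSet_Ioo, ?_⟩
    · -- the slice bound: Minkowski, `‖U‖ ≤ M`, the `L^p` block bound of `v`, `‖w‖ ≤ |δ| t^{-β₀}`
      have ht' : t ∈ Ioc 0 τ := ⟨ht.1, ht.2.le⟩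
      have hvLp : (eLpNorm (v t) (ENNReal.ofReal p) volume).toReal ≤
          E' * (t ^ (α - 1 / 2) + 1) + C' * hh t := by
        have h1 := hLp p hp t ht'
        have hq0 : 0 ≤ t ^ (α - 1 / 2) + 1 := by
          have := Real.rpow_nonneg ht.1.le (α - 1 / 2); positivity
        calc (eLpNorm (v t) (ENNReal.ofReal p) volume).toReal
            ≤ E * (t ^ (α - 1 / 2) + 1) + C * hh t := h1
          _ ≤ E' * (t ^ (α - 1 / 2) + 1) + C' * hh t :=
              add_le_add (mul_le_mul_of_nonneg_right (le_max_left _ _) hq0)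
                (mul_le_mul_of_nonneg_right (le_max_left _ _) (hh0 t))
      have h := toReal_eLpNorm_add_three_le (p := ENNReal.ofReal p) (ENNReal.one_le_ofReal.2 hp)
        (hUts t ht').continuous (hvs t ht').continuous (hws t ht').continuous (hM t ht')
        (hwb' t ht')
      calc (eLpNorm (u t) (ENNReal.ofReal p) volume).toReal
          ≤ M + (eLpNorm (v t) (ENNReal.ofReal p) volume).toReal + |δ| * t ^ (-β₀) := h
        _ ≤ Φ t := by simp only [hΦdef]; linarith
    · -- square integrability: `Φ² ≤ 4 (M² + E'²(t^{α-1/2}+1)² + C'² hh² + δ² t^{-2β₀})`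
      have hI3 : IntegrableOn (fun t => hh t ^ 2) (Ioo 0 τ) := by
        refine ⟨(hhc.pow 2).aestronglyMeasurable measurableSet_Ioo, ?_⟩
        show ∫⁻ t, ‖hh t ^ 2‖ₑ ∂(volume.restrict (Ioo 0 τ)) < ⊤
        calc ∫⁻ t in Ioo 0 τ, ‖hh t ^ 2‖ₑ = ∫⁻ t in Ioo 0 τ, ENNReal.ofReal (hh t ^ 2) :=
              lintegral_congr fun t => Real.enorm_eq_ofReal (sq_nonneg _)
          _ ≤ ∫⁻ t in Ioi 0, ENNReal.ofReal (hh t ^ 2) := lintegral_mono_set Ioo_subset_Ioi_self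
          _ ≤ ENNReal.ofReal ((∑' k, ε k) ^ 2 / (2 * c)) := lintegral_sq_tsum_le hε0 hεs hN hc
          _ < ⊤ := ENNReal.ofReal_lt_top
      have h1 : IntegrableOn (fun t : ℝ => t ^ (-(1 - 2 * α))) (Ioo 0 τ) :=
        integrableOn_rpow_neg_Ioo (by linarith) hτ.le
      have h2 : IntegrableOn (fun t : ℝ => t ^ (-(1 / 2 - α))) (Ioo 0 τ) :=
        integrableOn_rpow_neg_Ioo (by linarith) hτ.le
      have h4 : IntegrableOn (fun t : ℝ => t ^ (-(2 * β₀))) (Ioo 0 τ) :=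
        integrableOn_rpow_neg_Ioo (by linarith) hτ.le
      have hconst : IntegrableOn (fun _ : ℝ => (1 : ℝ)) (Ioo 0 τ) :=
        integrableOn_const (by rw [Real.volume_Ioo]; exact ENNReal.ofReal_ne_top)
      have hmaj : IntegrableOn (fun t : ℝ => 4 * (M ^ 2 * 1 +
          E' ^ 2 * (t ^ (-(1 - 2 * α)) + 2 * t ^ (-(1 / 2 - α)) + 1) +
          C' ^ 2 * hh t ^ 2 + δ ^ 2 * t ^ (-(2 * β₀)))) (Ioo 0 τ) :=
        ((((hconst.const_mul _).add (((h1.add (h2.const_mul 2)).add hconst).const_mul _)).add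
          (hI3.const_mul _)).add (h4.const_mul _)).const_mul 4
      refine Integrable.mono' hmaj ((hcΦ.pow 2).aestronglyMeasurable measurableSet_Ioo) ?_
      filter_upwards [ae_restrict_mem measurableSet_Ioo] with t ht
      have e1 : t ^ (-(1 - 2 * α)) = (t ^ (α - 1 / 2)) ^ 2 := by
        rw [← Real.rpow_natCast, ← Real.rpow_mul ht.1.le]
        congr 1
        push_cast
        ring
      have e2 : t ^ (-(1 / 2 - α)) = t ^ (α - 1 / 2) := by
        congr 1
        ring
      have e4 : t ^ (-(2 * β₀)) = (t ^ (-β₀)) ^ 2 := by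
        rw [← Real.rpow_natCast, ← Real.rpow_mul ht.1.le]
        congr 1
        push_cast
        ring
      have hδ : δ ^ 2 = |δ| ^ 2 := (sq_abs δ).symm
      rw [Real.norm_eq_abs, abs_of_nonneg (sq_nonneg _), e1, e2, e4, hδ]
      have key : ∀ a₁ a₂ a₃ a₄ : ℝ, (a₁ + a₂ + a₃ + a₄) ^ 2 ≤ 4 * (a₁ ^ 2 + a₂ ^ 2 + a₃ ^ 2 + a₄ ^ 2) :=
        fun a₁ a₂ a₃ a₄ => by
          nlinarith [sq_nonneg (a₁ - a₂), sq_nonneg (a₁ - a₃), sq_nonneg (a₁ - a₄),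
            sq_nonneg (a₂ - a₃), sq_nonneg (a₂ - a₄), sq_nonneg (a₃ - a₄)]
      have hk := key M (E' * (t ^ (α - 1 / 2) + 1)) (C' * hh t) (|δ| * t ^ (-β₀))
      calc Φ t ^ 2 = (M + E' * (t ^ (α - 1 / 2) + 1) + C' * hh t + |δ| * t ^ (-β₀)) ^ 2 := by
            simp only [hΦdef]; ring
        _ ≤ 4 * (M ^ 2 + (E' * (t ^ (α - 1 / 2) + 1)) ^ 2 + (C' * hh t) ^ 2 +
              (|δ| * t ^ (-β₀)) ^ 2) := hk
        _ = 4 * (M ^ 2 * 1 + E' ^ 2 * ((t ^ (α - 1 / 2)) ^ 2 + 2 * t ^ (α - 1 / 2) + 1) +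
              C' ^ 2 * hh t ^ 2 + |δ| ^ 2 * (t ^ (-β₀)) ^ 2) := by ring
  refine ⟨v, w, q, hcl, hvs, ?_, ⟨δ, β₀, β₁, hβ₀, hβ₁, hwb⟩, hlow, hvlim, hwlim, ?_, ?_, ?_, ?_⟩
  · -- Type-I bounds of `v` (Prop. 4.3 (v-pointwise-bounds))
    set K₀ : ℝ := E' * (τ ^ α + Real.sqrt τ) + C' * C₁ with hK₀
    set K₁ : ℝ := E' * (τ ^ α + τ) + C' * C₂ with hK₁
    refine ⟨max K₀ K₁, fun t ht x => ⟨?_, ?_⟩⟩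
    · have hst : 0 < Real.sqrt t := Real.sqrt_pos.2 ht.1
      have h1 : t ^ (α - 1 / 2) ≤ τ ^ α / Real.sqrt t := by
        rw [Real.rpow_sub ht.1, Real.sqrt_eq_rpow]
        exact div_le_div_of_nonneg_right (Real.rpow_le_rpow ht.1.le ht.2 hα.le)
          (Real.rpow_nonneg ht.1.le _)
      have h2 : (1 : ℝ) ≤ Real.sqrt τ / Real.sqrt t := by
        rw [le_div_iff₀ hst, one_mul]
        exact Real.sqrt_le_sqrt ht.2
      have h3 : g t ≤ C₁ / Real.sqrt t := hgle t ht.1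
      calc ‖v t x‖ ≤ E' * (t ^ (α - 1 / 2) + 1) + C' * g t := hv1 t ht x
        _ ≤ E' * (τ ^ α / Real.sqrt t + Real.sqrt τ / Real.sqrt t) + C' * (C₁ / Real.sqrt t) := by
            gcongr
        _ = K₀ / Real.sqrt t := by rw [hK₀]; field_simp
        _ ≤ max K₀ K₁ / Real.sqrt t := div_le_div_of_nonneg_right (le_max_left _ _) hst.le
    · have h1 : t ^ (α - 1) ≤ τ ^ α / t := by
        rw [Real.rpow_sub ht.1, Real.rpow_one]
        exact div_le_div_of_nonneg_right (Real.rpow_le_rpow ht.1.le ht.2 hα.le) ht.1.le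
      have h2 : (1 : ℝ) ≤ τ / t := by
        rw [le_div_iff₀ ht.1, one_mul]
        exact ht.2
      have h3 : g₂ t ≤ C₂ / t := hg₂le t ht.1
      calc ‖FunctionSpaces.Torus.fderiv (v t) x‖ ≤ E' * (t ^ (α - 1) + 1) + C' * g₂ t := hDv1 t ht x
        _ ≤ E' * (τ ^ α / t + τ / t) + C' * (C₂ / t) := by gcongr
        _ = K₁ / t := by rw [hK₁]; field_simp
        _ ≤ max K₀ K₁ / t := div_le_div_of_nonneg_right (le_max_right _ _) ht.1.le
  · -- `u ∈ L²((0,τ) × 𝕋ⁿ)` (Prop. 6.2)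
    obtain ⟨Φ, hle, -, hΦi⟩ := hΦ 2 (by norm_num)
    simp only [ENNReal.ofReal_ofNat] at hle
    exact lintegral_lintegral_sq_lt_top_of_le (fun t ht => (hus t ⟨ht.1, ht.2.le⟩).continuous)
      hle hΦi
  · -- `u ∈ L²(0,τ; L^p(𝕋ⁿ))` for all `1 ≤ p < ∞` (Prop. 6.2)
    intro p hp
    obtain ⟨Φ, hle, hΦm, hΦi⟩ := hΦ p hp
    exact memLqLp_two_of_le (fun t ht => (hus t ⟨ht.1, ht.2.le⟩).continuous) hle hΦm hΦi
  · -- Orlicz bound (5a) for `v`: `sup ‖v‖ ≤ a + b`, `a = E'(t^{α-1/2}+1) ∈ L²`, `b = C' g`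
    have hSv0 : ∀ t, 0 ≤ ⨆ y, ‖v t y‖ := fun t => Real.iSup_nonneg fun y => norm_nonneg _
    have ha0 : ∀ t ∈ Ioc 0 τ, 0 ≤ E' * (t ^ (α - 1 / 2) + 1) := fun t ht => by
      have := Real.rpow_nonneg ht.1.le (α - 1 / 2); positivity
    have hb0 : ∀ t, 0 ≤ C' * g t := fun t => mul_nonneg hC'0 (hg0 t)
    have hSv : ∀ t ∈ Ioc 0 τ, (⨆ y, ‖v t y‖) ≤ E' * (t ^ (α - 1 / 2) + 1) + C' * g t :=
      fun t ht => ciSup_le fun x => hv1 t ht x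
    have hbm : AEStronglyMeasurable (fun t => C' * g t) (volume.restrict (Ioo 0 τ)) :=
      (continuousOn_const.mul hgc).aestronglyMeasurable measurableSet_Ioo
    have hIb : IntegrableOn (fun t => (C' * g t) ^ 2 /
        (1 + Real.log (Real.log (Real.exp 1 + C' * g t)) ^ (2 : ℝ))) (Ioo 0 τ) :=
      integrableOn_orliczF_of_le_tsum_lacunary hN hlac hκ hgrow hc hbm (fun t _ => hb0 t)
        (fun t _ => le_rfl)
    have hdom : IntegrableOn (fun t => 4 * (E' * (t ^ (α - 1 / 2) + 1)) ^ 2 +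
        4 * ((C' * g t) ^ 2 / (1 + Real.log (Real.log (Real.exp 1 + C' * g t)) ^ 2)))
        (Ioo 0 τ) := by
      refine IntegrableOn.add ?_ ?_
      · have h1 : IntegrableOn (fun t : ℝ => t ^ (-(1 - 2 * α))) (Ioo 0 τ) :=
          integrableOn_rpow_neg_Ioo (by linarith) hτ.le
        have h2 : IntegrableOn (fun t : ℝ => t ^ (-(1 / 2 - α))) (Ioo 0 τ) :=
          integrableOn_rpow_neg_Ioo (by linarith) hτ.le
        have hconst : IntegrableOn (fun _ : ℝ => (1 : ℝ)) (Ioo 0 τ) :=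
          integrableOn_const (by rw [Real.volume_Ioo]; exact ENNReal.ofReal_ne_top)
        have h3 : IntegrableOn (fun t : ℝ => 4 * (E' ^ 2 *
            (t ^ (-(1 - 2 * α)) + 2 * t ^ (-(1 / 2 - α)) + 1))) (Ioo 0 τ) :=
          (((h1.add (h2.const_mul 2)).add hconst).const_mul _).const_mul 4
        refine IntegrableOn.congr_fun h3 (fun t ht => ?_) measurableSet_Ioo
        have e1 : t ^ (-(1 - 2 * α)) = (t ^ (α - 1 / 2)) ^ 2 := by
          rw [← Real.rpow_natCast, ← Real.rpow_mul ht.1.le]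
          congr 1
          push_cast
          ring
        have e2 : t ^ (-(1 / 2 - α)) = t ^ (α - 1 / 2) := by
          congr 1
          ring
        show 4 * (E' ^ 2 * (t ^ (-(1 - 2 * α)) + 2 * t ^ (-(1 / 2 - α)) + 1)) =
          4 * (E' * (t ^ (α - 1 / 2) + 1)) ^ 2
        rw [e1, e2]
        ring
      · have h : IntegrableOn (fun t => 4 * ((C' * g t) ^ 2 /
            (1 + Real.log (Real.log (Real.exp 1 + C' * g t)) ^ (2 : ℝ)))) (Ioo 0 τ) :=
          hIb.const_mul 4
        refine IntegrableOn.congr_fun h (fun t _ => ?_) measurableSet_Ioo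
        simp only [Real.rpow_two]
    have hSvc : ContinuousOn (fun t => ⨆ y, ‖v t y‖) (Ioc 0 τ) := continuousOn_iSup_norm' hvst
    have hFc := continuousOn_orliczWeight' two_pos 2 hSvc hSv0
    refine Integrable.mono' hdom ((hFc.mono Ioo_subset_Ioc_self).aestronglyMeasurable measurableSet_Ioo) ?_
    filter_upwards [ae_restrict_mem measurableSet_Ioo] with t ht
    have ht' : t ∈ Ioc 0 τ := ⟨ht.1, ht.2.le⟩
    rw [Real.norm_eq_abs, abs_of_nonneg (by
      have := Real.rpow_nonneg (loglog_nonneg (hSv0 t)) (2:ℝ); positivity)]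
    simp only [Real.rpow_two]
    exact orliczF_le_of_le_add (hSv0 t) (ha0 t ht') (hb0 t) (hSv t ht')
  · -- Orlicz bound (5b) for `∇v`: `sup ‖∇v‖ ≤ a + b`, `a = E'(t^{α-1}+1) ∈ L¹`, `b = C' g₂`
    have hSv0 : ∀ t, 0 ≤ ⨆ y, ‖FunctionSpaces.Torus.fderiv (v t) y‖ := fun t =>
      Real.iSup_nonneg fun y => norm_nonneg _
    have ha0 : ∀ t ∈ Ioc 0 τ, 0 ≤ E' * (t ^ (α - 1) + 1) := fun t ht => by
      have := Real.rpow_nonneg ht.1.le (α - 1); positivity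
    have hb0 : ∀ t, 0 ≤ C' * g₂ t := fun t => mul_nonneg hC'0 (hg₂0 t)
    have hSv : ∀ t ∈ Ioc 0 τ, (⨆ y, ‖FunctionSpaces.Torus.fderiv (v t) y‖) ≤
        E' * (t ^ (α - 1) + 1) + C' * g₂ t := by
      intro t ht
      exact ciSup_le fun x => hDv1 t ht x
    have hbm : AEStronglyMeasurable (fun t => C' * g₂ t) (volume.restrict (Ioo 0 τ)) :=
      (continuousOn_const.mul hg₂c).aestronglyMeasurable measurableSet_Ioo
    have hIb : IntegrableOn (fun t => (C' * g₂ t) /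
        (1 + Real.log (Real.log (Real.exp 1 + C' * g₂ t)) ^ (2 : ℝ))) (Ioo 0 τ) :=
      integrableOn_orliczH_of_le_tsum_lacunary hN hlac hκ hgrow hc hbm (fun t _ => hb0 t)
        (fun t _ => le_rfl)
    have hdom : IntegrableOn (fun t => 2 * (E' * (t ^ (α - 1) + 1)) +
        2 * ((C' * g₂ t) / (1 + Real.log (Real.log (Real.exp 1 + C' * g₂ t)) ^ 2)))
        (Ioo 0 τ) := by
      refine IntegrableOn.add ?_ ?_
      · have h1 : IntegrableOn (fun t : ℝ => t ^ (-(1 - α))) (Ioo 0 τ) :=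
          integrableOn_rpow_neg_Ioo (by linarith) hτ.le
        have hconst : IntegrableOn (fun _ : ℝ => (1 : ℝ)) (Ioo 0 τ) :=
          integrableOn_const (by rw [Real.volume_Ioo]; exact ENNReal.ofReal_ne_top)
        have h3 : IntegrableOn (fun t : ℝ => 2 * (E' * (t ^ (-(1 - α)) + 1))) (Ioo 0 τ) :=
          ((h1.add hconst).const_mul _).const_mul 2
        refine IntegrableOn.congr_fun h3 (fun t _ => ?_) measurableSet_Ioo
        have e1 : t ^ (-(1 - α)) = t ^ (α - 1) := by
          congr 1
          ring
        show 2 * (E' * (t ^ (-(1 - α)) + 1)) = 2 * (E' * (t ^ (α - 1) + 1))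
        rw [e1]
      · have h : IntegrableOn (fun t => 2 * ((C' * g₂ t) /
            (1 + Real.log (Real.log (Real.exp 1 + C' * g₂ t)) ^ (2 : ℝ)))) (Ioo 0 τ) :=
          hIb.const_mul 2
        refine IntegrableOn.congr_fun h (fun t _ => ?_) measurableSet_Ioo
        simp only [Real.rpow_two]
    have hSvc : ContinuousOn (fun t => ⨆ y, ‖FunctionSpaces.Torus.fderiv (v t) y‖) (Ioc 0 τ) :=
      continuousOn_iSup_norm_fderiv' (uniqueDiffOn_Ioc 0 τ) hvst
    have hHc := continuousOn_orliczWeight' two_pos 1 hSvc hSv0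
    simp only [pow_one] at hHc
    refine Integrable.mono' hdom ((hHc.mono Ioo_subset_Ioc_self).aestronglyMeasurable measurableSet_Ioo) ?_
    filter_upwards [ae_restrict_mem measurableSet_Ioo] with t ht
    have ht' : t ∈ Ioc 0 τ := ⟨ht.1, ht.2.le⟩
    rw [Real.norm_eq_abs, abs_of_nonneg (by
      have := Real.rpow_nonneg (loglog_nonneg (hSv0 t)) (2:ℝ)
      exact div_nonneg (hSv0 t) (by positivity))]
    simp only [Real.rpow_two]
    exact orliczH_le_of_le_add (hSv0 t) (ha0 t ht') (hb0 t) (hSv t ht')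

/-- **The barrier fact from the block-bound level** (composition of `construction_of_blockBounds`
with `InstantaneousTypeIBlowup_of_decomposition`).
[cite: CheskidovDaiPalasek2025, Prop. 4.3, Prop. 5.3, Prop. 6.2, §6 (proof of Thm. 1.1)] -/
theorem InstantaneousTypeIBlowup_of_blockBounds
    (h₃ : ∀ (n : ℕ), 2 ≤ n → ∃ T₁ : ℝ, 0 < T₁ ∧ ∀ (T : ℝ), 0 < T → T ≤ T₁ →
      ∀ (U : ℝ → UnitAddTorus (Fin n) → EuclideanSpace ℝ (Fin n))
        (P : ℝ → UnitAddTorus (Fin n) → ℝ),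
        FunctionSpaces.Torus.IsClassicalNSSolutionOn (Icc 0 T) 1 0 U P →
        ∀ Ts : ℝ, 0 ≤ Ts → Ts < T →
          ∃ (v w : ℝ → UnitAddTorus (Fin n) → EuclideanSpace ℝ (Fin n))
            (q : ℝ → UnitAddTorus (Fin n) → ℝ),
            FunctionSpaces.Torus.IsClassicalNSSolutionOn (Ioc 0 (T - Ts)) 1 0
              (fun t x => U (t + Ts) x + v t x + w t x) q ∧
            IsSmoothSpaceTimeOn (Ioc 0 (T - Ts)) v ∧
            (∃ (N : ℕ → ℝ) (κ c α C E : ℝ), (∀ k, 0 < N k) ∧ (∀ k, 2 * N k ≤ N (k + 1)) ∧ 0 < κ ∧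
              (∀ k : ℕ, Real.exp (Real.exp (κ * (k + 1))) ≤ N k) ∧ 0 < c ∧ 0 < α ∧
              (∀ t ∈ Ioc 0 (T - Ts), ∀ x,
                ‖v t x‖ ≤ E * (t ^ (α - 1 / 2) + 1) + C * ∑' k, N k * Real.exp (-(c * N k ^ 2 * t)) ∧
                ‖FunctionSpaces.Torus.fderiv (v t) x‖ ≤
                  E * (t ^ (α - 1) + 1) + C * ∑' k, N k ^ 2 * Real.exp (-(c * N k ^ 2 * t))) ∧
              (∀ p : ℝ, 1 ≤ p → ∀ t ∈ Ioc 0 (T - Ts),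
                (eLpNorm (v t) (ENNReal.ofReal p) volume).toReal ≤
                  E * (t ^ (α - 1 / 2) + 1) +
                    C * ∑' k : ℕ, (2 : ℝ) ^ (-((k : ℝ) / p)) * N k * Real.exp (-(c * N k ^ 2 * t)))) ∧
            (∃ δ β₀ β₁ : ℝ, β₀ < 1 / 2 ∧ β₁ < 1 ∧ ∀ t ∈ Ioc 0 (T - Ts), ∀ x,
              ‖w t x‖ ≤ δ * t ^ (-β₀) ∧ ‖FunctionSpaces.Torus.fderiv (w t) x‖ ≤ δ * t ^ (-β₁)) ∧
            (∃ c₀ : ℝ, 0 < c₀ ∧ ∃ s : ℕ → ℝ, (∀ k, 0 < s k ∧ s k ≤ T - Ts) ∧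
              Tendsto s atTop (𝓝 0) ∧ ∀ k, ∃ x, c₀ / Real.sqrt (s k) ≤ ‖v (s k) x‖) ∧
            (∀ φ : UnitAddTorus (Fin n) → EuclideanSpace ℝ (Fin n), IsSmooth φ →
              Tendsto (fun t => ∫ x, ⟪v t x, φ x⟫_ℝ) (𝓝[>] 0) (𝓝 0)) ∧
            (∀ φ : UnitAddTorus (Fin n) → EuclideanSpace ℝ (Fin n), IsSmooth φ →
              Tendsto (fun t => ∫ x, ⟪w t x, φ x⟫_ℝ) (𝓝[>] 0) (𝓝 0))) :
    InstantaneousTypeIBlowup :=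
  InstantaneousTypeIBlowup_of_decomposition (construction_of_blockBounds h₃)

end Blocks

end Literature.Barriers.NavierStokesRegularity
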